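import Summits.BirchSwinnertonDyer.BirchSwinnertonDyer.Theorems.ByReductionTypeAtTwoFineSelmerConjAAtTwoAdditivePotGoodClassNumberOned6756n
import Summits.BirchSwinnertonDyer.BirchSwinnertonDyer.Theorems.ByReductionTypeAtTwoFineSelmerConjAAtTwoAdditivePotGoodClassNumberOned63644p
import Summits.BirchSwinnertonDyer.BirchSwinnertonDyer.Theorems.ByReductionTypeAtTwoFineSelmerConjAAtTwoAdditivePotGoodClassNumberOned51992p
import Summits.BirchSwinnertonDyer.BirchSwinnertonDyer.Theorems.ByReductionTypeAtTwoFineSelmerConjAAtTwoAdditivePotGoodChevalleyOneBitDoor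
import HarnessLib

/-!
# Census rows with NO displayed bit: the one-bit rows closed by Chevalley's door at `p = 2`

Sub-problem `BirchSwinnertonDyer`, route `ByReductionTypeAtTwo`, item `FineSelmerConjAAtTwoAdditivePotGood` (C1″), helper file
(census currency).  Rows: `297264q1`, `445508b1`, `467928d1`.  Each former one-bit stamp `conjA_two_<L>_of_layerOneBit hLim2 hθ h1`
displayed `h1 : ∀ κL cyclotomic over ℚ(θ), e₁(κL) = 0` (`2 ∤ h(ℚ(θ, √2))`); here `h1` is DISCHARGED by
`layerOneBit_of_chevalleyCert` (file `…ChevalleyOneBitDoor`): Chevalley's ambiguous class number formula for `ℚ(θ,√2)/ℚ(θ)`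
with a unit of `ℚ(θ)` whose `2`-adic image is `≡ ±3 (mod 8)` (not a norm), `2 ∤ h(ℚ(θ))` (kernel certificate already in the
tree) and at most two primes above `2` (two `4 ∤ g` witnesses).  Result: `conjA_two_<L> hLim2 hθ κ hκ` — the row is conditional on
`hLim2` ALONE, like the Fukuda / unique-prime rows.

## What this does NOT prove
`hLim2` (Lim 2017, Thm. 3.5 at `p = 2`) remains an input in print; Conjecture A itself and BSD are not advanced by these stamps.
-/

set_option autoImplicit false
set_option linter.dupNamespace false

noncomputable section

open scoped Classical IntermediateField NumberField Real nonZeroDivisors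

namespace Summit.BirchSwinnertonDyer.BirchSwinnertonDyer.Theorems.AddKatoTwo

open WeierstrassCurve Field Polynomial IsDedekindDomain NumberField Matrix Literature.NumberTheory.EllipticCurves
  Literature.NumberTheory.IwasawaTheory

/-- **Row `297264q1` — NO displayed bit left (`hLim2` ALONE).**  `K = ℚ(θ)`, `θ³ + 0θ² − 51θ − 148 = 0`:
the former displayed bit `e₁ = 0` (`2 ∤ h(K(√2))`) is DECIDED by Chevalley's door at `p = 2` with the certificate
unit `ε = (-30620405 + -2538278θ + 750750θ²)/1` (`ε³ + (15284715)ε² + (106717013294091)ε + (1) = 0`), Hensel datum `a = 4` (`8 ∣ g(4)`, `g'(4)` odd) and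
`ε ≡ 3 (mod 8)` under `θ ↦ z ≡ 4`: `(ε, 2)₂ = −1`; at most two primes above `2` by `4 ∤ g(2)`, `4 ∤ g(1)`.
Remaining input: `hLim2` (Lim's Theorem 3.5 at `p = 2`, in print).  BSD is not advanced by this stamp. -/
theorem conjA_two_297264q1
    (hLim2 : Lim2017.thm35_at_two_fineSelmerDual_moduleFinite_of_classicalMuVanishes_of_le_divisionField_four)
    {θ : AlgebraicClosure ℚ} (hθ : aeval θ (Cubic.toPoly ⟨1, ((0 : ℤ) : ℚ), ((-51 : ℤ) : ℚ), ((-148 : ℤ) : ℚ)⟩) = 0)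
    (κ : ZpExtension ℚ 2) (hκ : κ.IsCyclotomic) :
    haveI := isElliptic_297264q1'
    ∃ (γ : absoluteGaloisGroup ℚ) (D : (⟨0, ((-1 : ℤ) : ℚ), 0, ((-80195004 : ℤ) : ℚ), ((-286282093668 : ℤ) : ℚ)⟩ : WeierstrassCurve ℚ).FineSelmerDualData κ γ),
      Module.Finite ℤ_[2] (RestrictScalars ℤ_[2] (IwasawaAlgebra 2) D.X) := by
  haveI := isElliptic_297264q1'
  have hθ' : θ ^ 3 + (0 : AlgebraicClosure ℚ) * θ ^ 2 + (-51 : AlgebraicClosure ℚ) * θ + (-148 : AlgebraicClosure ℚ) = 0 := by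
    have := hθ
    simp only [Cubic.toPoly, map_one, one_mul, aeval_add, aeval_mul, aeval_C, aeval_X_pow, aeval_X,
      eq_ratCast, Rat.cast_intCast] at this
    push_cast at this
    linear_combination this
  set θ₁ : AlgebraicClosure ℚ := algebraMap ℚ (AlgebraicClosure ℚ) (35 / 3 : ℚ) +
      algebraMap ℚ (AlgebraicClosure ℚ) (5 / 3 : ℚ) * θ + algebraMap ℚ (AlgebraicClosure ℚ) (-1 / 3 : ℚ) * θ ^ 2 with hθ₁def
  have hθ₁ : aeval θ₁ (Cubic.toPoly ⟨1, ((-1 : ℤ) : ℚ), ((9 : ℤ) : ℚ), ((-33 : ℤ) : ℚ)⟩) = 0 := by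
    simp only [Cubic.toPoly, map_one, one_mul, aeval_add, aeval_mul, aeval_C, aeval_X_pow, aeval_X, eq_ratCast,
      Rat.cast_intCast]
    rw [hθ₁def]
    simp only [eq_ratCast]
    push_cast
    linear_combination (((-278 : AlgebraicClosure ℚ) / 27) + ((-8 : AlgebraicClosure ℚ) / 9) * θ + ((5 : AlgebraicClosure ℚ) / 9) * θ ^ 2 + ((-1 : AlgebraicClosure ℚ) / 27) * θ ^ 3) * hθ'
  have hadj : IntermediateField.adjoin ℚ {θ₁} = IntermediateField.adjoin ℚ {θ} := by
    apply le_antisymm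
    · rw [IntermediateField.adjoin_simple_le_iff, hθ₁def]
      have hθmem := IntermediateField.mem_adjoin_simple_self ℚ θ
      exact add_mem (add_mem (algebraMap_mem _ _) (mul_mem (algebraMap_mem _ _) hθmem))
        (mul_mem (algebraMap_mem _ _) (pow_mem hθmem 2))
    · rw [IntermediateField.adjoin_simple_le_iff]
      have hθeq : θ = algebraMap ℚ (AlgebraicClosure ℚ) (5 / 2 : ℚ) + algebraMap ℚ (AlgebraicClosure ℚ) (1 : ℚ) * θ₁ +
          algebraMap ℚ (AlgebraicClosure ℚ) (1 / 2 : ℚ) * θ₁ ^ 2 := by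
        rw [hθ₁def]; simp only [eq_ratCast]; push_cast; linear_combination (((5 : AlgebraicClosure ℚ) / 9) + ((-1 : AlgebraicClosure ℚ) / 18) * θ) * hθ'
      rw [hθeq]
      have hθ₁mem := IntermediateField.mem_adjoin_simple_self ℚ θ₁
      exact add_mem (add_mem (algebraMap_mem _ _) (mul_mem (algebraMap_mem _ _) hθ₁mem))
        (mul_mem (algebraMap_mem _ _) (pow_mem hθ₁mem 2))
  have hh : ¬ 2 ∣ Nat.card (ClassGroup (𝓞 (IntermediateField.adjoin ℚ {θ}))) := by
    rw [← hadj]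
    exact not_two_dvd_card_classGroup_adjoin_of_forall_cubicField irreducible_cubic_d6756n_min (classNumber_eq_one_of_root_d6756n) hθ₁
  have he : aeval (algebraMap ℚ (AlgebraicClosure ℚ) (((-30620405 : ℤ) : ℚ) / ((1 : ℤ) : ℚ)) +
      algebraMap ℚ (AlgebraicClosure ℚ) (((-2538278 : ℤ) : ℚ) / ((1 : ℤ) : ℚ)) * θ +
      algebraMap ℚ (AlgebraicClosure ℚ) (((750750 : ℤ) : ℚ) / ((1 : ℤ) : ℚ)) * θ ^ 2)
      (Cubic.toPoly ⟨1, ((15284715 : ℤ) : ℚ), ((106717013294091 : ℤ) : ℚ), ((1 : ℤ) : ℚ)⟩) = 0 := by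
    simp only [Cubic.toPoly, map_one, one_mul, aeval_add, aeval_mul, aeval_C, aeval_X_pow, aeval_X, eq_ratCast,
      Rat.cast_intCast, Rat.cast_div]
    push_cast
    linear_combination ((119233798892279764048 : AlgebraicClosure ℚ) + (-7069315807289736000 : AlgebraicClosure ℚ) * θ + (-4291915096594125000 : AlgebraicClosure ℚ) * θ ^ 2 + (423141891046875000 : AlgebraicClosure ℚ) * θ ^ 3) * hθ'
  exact conjA_two_297264q1_of_layerOneBit hLim2 hθ
    (layerOneBit_of_chevalleyCert irreducible_cubic_d6756n hθ hh ⟨1, by norm_num⟩ ⟨0, by norm_num⟩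
      (-30620405) (-2538278) (750750) (1) (15284715) (106717013294091) (1) (by norm_num) he (4) (1) (by norm_num) (by norm_num) (by decide) (by decide)) κ hκ

/-- **Row `445508b1` — NO displayed bit left (`hLim2` ALONE).**  `K = ℚ(θ)`, `θ³ − 1θ² − 112θ − 270 = 0`:
the former displayed bit `e₁ = 0` (`2 ∤ h(K(√2))`) is DECIDED by Chevalley's door at `p = 2` with the certificate
unit `ε = (20603 + 6114θ + -646θ²)/7` (`ε³ + (11061)ε² + (9259)ε + (-1) = 0`), Hensel datum `a = 7` (`8 ∣ g(7)`, `g'(7)` odd) and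
`ε ≡ 5 (mod 8)` under `θ ↦ z ≡ 7`: `(ε, 2)₂ = −1`; at most two primes above `2` by `4 ∤ g(0)`, `4 ∤ g(1)`.
Remaining input: `hLim2` (Lim's Theorem 3.5 at `p = 2`, in print).  BSD is not advanced by this stamp. -/
theorem conjA_two_445508b1
    (hLim2 : Lim2017.thm35_at_two_fineSelmerDual_moduleFinite_of_classicalMuVanishes_of_le_divisionField_four)
    {θ : AlgebraicClosure ℚ} (hθ : aeval θ (Cubic.toPoly ⟨1, ((-1 : ℤ) : ℚ), ((-112 : ℤ) : ℚ), ((-270 : ℤ) : ℚ)⟩) = 0)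
    (κ : ZpExtension ℚ 2) (hκ : κ.IsCyclotomic) :
    haveI := isElliptic_445508b1'
    ∃ (γ : absoluteGaloisGroup ℚ) (D : (⟨0, ((-1 : ℤ) : ℚ), 0, ((-14574772 : ℤ) : ℚ), ((-21411754440 : ℤ) : ℚ)⟩ : WeierstrassCurve ℚ).FineSelmerDualData κ γ),
      Module.Finite ℤ_[2] (RestrictScalars ℤ_[2] (IwasawaAlgebra 2) D.X) := by
  haveI := isElliptic_445508b1'
  have hθ' : θ ^ 3 + (-1 : AlgebraicClosure ℚ) * θ ^ 2 + (-112 : AlgebraicClosure ℚ) * θ + (-270 : AlgebraicClosure ℚ) = 0 := by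
    have := hθ
    simp only [Cubic.toPoly, map_one, one_mul, aeval_add, aeval_mul, aeval_C, aeval_X_pow, aeval_X,
      eq_ratCast, Rat.cast_intCast] at this
    push_cast at this
    linear_combination this
  set θ₁ : AlgebraicClosure ℚ := algebraMap ℚ (AlgebraicClosure ℚ) (-71 / 7 : ℚ) +
      algebraMap ℚ (AlgebraicClosure ℚ) (-5 / 7 : ℚ) * θ + algebraMap ℚ (AlgebraicClosure ℚ) (1 / 7 : ℚ) * θ ^ 2 with hθ₁def
  have hθ₁ : aeval θ₁ (Cubic.toPoly ⟨1, ((-1 : ℤ) : ℚ), ((-47 : ℤ) : ℚ), ((95 : ℤ) : ℚ)⟩) = 0 := by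
    simp only [Cubic.toPoly, map_one, one_mul, aeval_add, aeval_mul, aeval_C, aeval_X_pow, aeval_X, eq_ratCast,
      Rat.cast_intCast]
    rw [hθ₁def]
    simp only [eq_ratCast]
    push_cast
    linear_combination (((730 : AlgebraicClosure ℚ) / 343) + ((-47 : AlgebraicClosure ℚ) / 343) * θ + ((-2 : AlgebraicClosure ℚ) / 49) * θ ^ 2 + ((1 : AlgebraicClosure ℚ) / 343) * θ ^ 3) * hθ'
  have hadj : IntermediateField.adjoin ℚ {θ₁} = IntermediateField.adjoin ℚ {θ} := by
    apply le_antisymm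
    · rw [IntermediateField.adjoin_simple_le_iff, hθ₁def]
      have hθmem := IntermediateField.mem_adjoin_simple_self ℚ θ
      exact add_mem (add_mem (algebraMap_mem _ _) (mul_mem (algebraMap_mem _ _) hθmem))
        (mul_mem (algebraMap_mem _ _) (pow_mem hθmem 2))
    · rw [IntermediateField.adjoin_simple_le_iff]
      have hθeq : θ = algebraMap ℚ (AlgebraicClosure ℚ) (33 / 2 : ℚ) + algebraMap ℚ (AlgebraicClosure ℚ) (-1 : ℚ) * θ₁ +
          algebraMap ℚ (AlgebraicClosure ℚ) (-1 / 2 : ℚ) * θ₁ ^ 2 := by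
        rw [hθ₁def]; simp only [eq_ratCast]; push_cast; linear_combination (((-9 : AlgebraicClosure ℚ) / 98) + ((1 : AlgebraicClosure ℚ) / 98) * θ) * hθ'
      rw [hθeq]
      have hθ₁mem := IntermediateField.mem_adjoin_simple_self ℚ θ₁
      exact add_mem (add_mem (algebraMap_mem _ _) (mul_mem (algebraMap_mem _ _) hθ₁mem))
        (mul_mem (algebraMap_mem _ _) (pow_mem hθ₁mem 2))
  have hh : ¬ 2 ∣ Nat.card (ClassGroup (𝓞 (IntermediateField.adjoin ℚ {θ}))) := by
    rw [← hadj]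
    exact not_two_dvd_card_classGroup_adjoin_of_forall_cubicField irreducible_cubic_d63644p_min (classNumber_eq_one_of_root_d63644p) hθ₁
  have he : aeval (algebraMap ℚ (AlgebraicClosure ℚ) (((20603 : ℤ) : ℚ) / ((7 : ℤ) : ℚ)) +
      algebraMap ℚ (AlgebraicClosure ℚ) (((6114 : ℤ) : ℚ) / ((7 : ℤ) : ℚ)) * θ +
      algebraMap ℚ (AlgebraicClosure ℚ) (((-646 : ℤ) : ℚ) / ((7 : ℤ) : ℚ)) * θ ^ 2)
      (Cubic.toPoly ⟨1, ((11061 : ℤ) : ℚ), ((9259 : ℤ) : ℚ), ((-1 : ℤ) : ℚ)⟩) = 0 := by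
    simp only [Cubic.toPoly, map_one, one_mul, aeval_add, aeval_mul, aeval_C, aeval_X_pow, aeval_X, eq_ratCast,
      Rat.cast_intCast, Rat.cast_div]
    push_cast
    linear_combination (((-154153613280 : AlgebraicClosure ℚ) / 343) + ((-37147782968 : AlgebraicClosure ℚ) / 343) * θ + ((1054974848 : AlgebraicClosure ℚ) / 49) * θ ^ 2 + ((-269586136 : AlgebraicClosure ℚ) / 343) * θ ^ 3) * hθ'
  exact conjA_two_445508b1_of_layerOneBit hLim2 hθ
    (layerOneBit_of_chevalleyCert irreducible_cubic_d63644p hθ hh ⟨0, by norm_num⟩ ⟨0, by norm_num⟩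
      (20603) (6114) (-646) (7) (11061) (9259) (-1) (by norm_num) he (7) (7) (by norm_num) (by norm_num) (by decide) (by decide)) κ hκ

/-- **Row `467928d1` — NO displayed bit left (`hLim2` ALONE).**  `K = ℚ(θ)`, `θ³ − 1θ² − 102θ − 342 = 0`:
the former displayed bit `e₁ = 0` (`2 ∤ h(K(√2))`) is DECIDED by Chevalley's door at `p = 2` with the certificate
unit `ε = (59 + 7θ + -1θ²)/1` (`ε³ + (21)ε² + (-303)ε + (1) = 0`), Hensel datum `a = 5` (`8 ∣ g(5)`, `g'(5)` odd) and
`ε ≡ 5 (mod 8)` under `θ ↦ z ≡ 5`: `(ε, 2)₂ = −1`; at most two primes above `2` by `4 ∤ g(0)`, `4 ∤ g(3)`.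
Remaining input: `hLim2` (Lim's Theorem 3.5 at `p = 2`, in print).  BSD is not advanced by this stamp. -/
theorem conjA_two_467928d1
    (hLim2 : Lim2017.thm35_at_two_fineSelmerDual_moduleFinite_of_classicalMuVanishes_of_le_divisionField_four)
    {θ : AlgebraicClosure ℚ} (hθ : aeval θ (Cubic.toPoly ⟨1, ((-1 : ℤ) : ℚ), ((-102 : ℤ) : ℚ), ((-342 : ℤ) : ℚ)⟩) = 0)
    (κ : ZpExtension ℚ 2) (hκ : κ.IsCyclotomic) :
    haveI := isElliptic_467928d1'
    ∃ (γ : absoluteGaloisGroup ℚ) (D : (⟨0, ((0 : ℤ) : ℚ), 0, ((-434619795 : ℤ) : ℚ), ((-3475423424306 : ℤ) : ℚ)⟩ : WeierstrassCurve ℚ).FineSelmerDualData κ γ),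
      Module.Finite ℤ_[2] (RestrictScalars ℤ_[2] (IwasawaAlgebra 2) D.X) := by
  haveI := isElliptic_467928d1'
  have hθ' : θ ^ 3 + (-1 : AlgebraicClosure ℚ) * θ ^ 2 + (-102 : AlgebraicClosure ℚ) * θ + (-342 : AlgebraicClosure ℚ) = 0 := by
    have := hθ
    simp only [Cubic.toPoly, map_one, one_mul, aeval_add, aeval_mul, aeval_C, aeval_X_pow, aeval_X,
      eq_ratCast, Rat.cast_intCast] at this
    push_cast at this
    linear_combination this
  set θ₁ : AlgebraicClosure ℚ := algebraMap ℚ (AlgebraicClosure ℚ) (-22 : ℚ) +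
      algebraMap ℚ (AlgebraicClosure ℚ) (-7 / 3 : ℚ) * θ + algebraMap ℚ (AlgebraicClosure ℚ) (1 / 3 : ℚ) * θ ^ 2 with hθ₁def
  have hθ₁ : aeval θ₁ (Cubic.toPoly ⟨1, ((0 : ℤ) : ℚ), ((-50 : ℤ) : ℚ), ((-104 : ℤ) : ℚ)⟩) = 0 := by
    simp only [Cubic.toPoly, map_one, one_mul, aeval_add, aeval_mul, aeval_C, aeval_X_pow, aeval_X, eq_ratCast,
      Rat.cast_intCast]
    rw [hθ₁def]
    simp only [eq_ratCast]
    push_cast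
    linear_combination (((254 : AlgebraicClosure ℚ) / 9) + ((31 : AlgebraicClosure ℚ) / 27) * θ + ((-20 : AlgebraicClosure ℚ) / 27) * θ ^ 2 + ((1 : AlgebraicClosure ℚ) / 27) * θ ^ 3) * hθ'
  have hadj : IntermediateField.adjoin ℚ {θ₁} = IntermediateField.adjoin ℚ {θ} := by
    apply le_antisymm
    · rw [IntermediateField.adjoin_simple_le_iff, hθ₁def]
      have hθmem := IntermediateField.mem_adjoin_simple_self ℚ θ
      exact add_mem (add_mem (algebraMap_mem _ _) (mul_mem (algebraMap_mem _ _) hθmem))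
        (mul_mem (algebraMap_mem _ _) (pow_mem hθmem 2))
    · rw [IntermediateField.adjoin_simple_le_iff]
      have hθeq : θ = algebraMap ℚ (AlgebraicClosure ℚ) (17 : ℚ) + algebraMap ℚ (AlgebraicClosure ℚ) (1 : ℚ) * θ₁ +
          algebraMap ℚ (AlgebraicClosure ℚ) (-1 / 2 : ℚ) * θ₁ ^ 2 := by
        rw [hθ₁def]; simp only [eq_ratCast]; push_cast; linear_combination (((-13 : AlgebraicClosure ℚ) / 18) + ((1 : AlgebraicClosure ℚ) / 18) * θ) * hθ'
      rw [hθeq]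
      have hθ₁mem := IntermediateField.mem_adjoin_simple_self ℚ θ₁
      exact add_mem (add_mem (algebraMap_mem _ _) (mul_mem (algebraMap_mem _ _) hθ₁mem))
        (mul_mem (algebraMap_mem _ _) (pow_mem hθ₁mem 2))
  have hh : ¬ 2 ∣ Nat.card (ClassGroup (𝓞 (IntermediateField.adjoin ℚ {θ}))) := by
    rw [← hadj]
    exact not_two_dvd_card_classGroup_adjoin_of_forall_cubicField irreducible_cubic_d51992p_min (classNumber_eq_one_of_root_d51992p) hθ₁
  have he : aeval (algebraMap ℚ (AlgebraicClosure ℚ) (((59 : ℤ) : ℚ) / ((1 : ℤ) : ℚ)) +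
      algebraMap ℚ (AlgebraicClosure ℚ) (((7 : ℤ) : ℚ) / ((1 : ℤ) : ℚ)) * θ +
      algebraMap ℚ (AlgebraicClosure ℚ) (((-1 : ℤ) : ℚ) / ((1 : ℤ) : ℚ)) * θ ^ 2)
      (Cubic.toPoly ⟨1, ((21 : ℤ) : ℚ), ((-303 : ℤ) : ℚ), ((1 : ℤ) : ℚ)⟩) = 0 := by
    simp only [Cubic.toPoly, map_one, one_mul, aeval_add, aeval_mul, aeval_C, aeval_X_pow, aeval_X, eq_ratCast,
      Rat.cast_intCast, Rat.cast_div]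
    push_cast
    linear_combination ((-762 : AlgebraicClosure ℚ) + (-31 : AlgebraicClosure ℚ) * θ + (20 : AlgebraicClosure ℚ) * θ ^ 2 + (-1 : AlgebraicClosure ℚ) * θ ^ 3) * hθ'
  exact conjA_two_467928d1_of_layerOneBit hLim2 hθ
    (layerOneBit_of_chevalleyCert irreducible_cubic_d51992p hθ hh ⟨0, by norm_num⟩ ⟨1, by norm_num⟩
      (59) (7) (-1) (1) (21) (-303) (1) (by norm_num) he (5) (1) (by norm_num) (by norm_num) (by decide) (by decide)) κ hκ

end Summit.BirchSwinnertonDyer.BirchSwinnertonDyer.Theorems.AddKatoTwo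

end
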